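import Mathlib
import HarnessLib
import Literature.Analysis.FluidPDE.SelfSimilar
import Literature.Analysis.FluidPDE.LocalTypeI
import Literature.Analysis.FluidPDE.VectorCalculus
import Summits.NavierStokesRegularity.NavierStokesRegularity.Theorems.LocalSineTubeDoorProfileAlignedWindowRigidityAncient
import Summits.NavierStokesRegularity.NavierStokesRegularity.Theorems.PoloidalWindowDoorPoloidalWindowRigidityClassRate
import Summits.NavierStokesRegularity.NavierStokesRegularity.Theorems.PoloidalWindowDoorPoloidalWindowRigidityZShockAutonomyPropagation
import Summits.NavierStokesRegularity.NavierStokesRegularity.Theorems.PoloidalWindowDoorPoloidalWindowRigidityZShockEllipticPocket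

/-!
# Crux K2 `PoloidalWindowRigidity` (stmt-NavierStokesRegularity-19708), line `z_shock` — the DECIDING STUB `stub_zShockThickAut`
# REDUCED IN THE KERNEL to ONE class-free slice Liouville statement (GN branch) and the (TH)-instant residue

`--supports stmt-NavierStokesRegularity-19708 --as helper` (leafhand-ns-poloidalwindowdoor-3 g12, cell decomp-ns, 2026-08-31).  Def-free;
tree files only.  **No stub and no summit is closed by this file; Navier–Stokes regularity is NOT proved here (rung 0).**

The ~95 `…ZShock*` helper files typed the rungs R2/L0/R3-entrance of the card `Cruxes/PoloidalWindowRigidity/Lines/z_shock.md` but none of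
them concludes the registered type of the deciding stub.  This file does the bookkeeping the next lead / planner needs: the theorem
`stub_zShockThickAut_of_sliceLiouville_of_thInstant` has EXACTLY the registered type of `stub_zShockThickAut` (skeleton sha16 c3e8eee2) as
its conclusion and two explicit hypotheses:

* `hGN` — a CLASS-FREE statement about ONE vector field `u : ℝ³ → ℝ³` (the slice `v(t₀,·)` at the densely hyperbolic time `t₀ = z₀.1`):
  real-analytic, bounded, bounded gradient, divergence-free, poloidal along `e₃`, the (M)-frozen WEDGE LAW `∂₂u₀∂₁u₂ = ∂₂u₁∂₀u₂`, the
  AUTONOMY MINORS of L0(a) (`D_b ∥ ∇u₂`, `b = 0,1`, verbatim the conclusion of `…ZShockAutonomyGlobal.minors_eq_zero_of_class_autonomy`), NO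
  strictly elliptic point (`E ≤ 0` on `ℝ³`, `E = ∂₂u₀∂₀u₂ + ∂₂u₁∂₁u₂`), ONE strictly hyperbolic point, ONE twisting point
  (`∇ₕ(∂₂u₂) ∧ ∇ₕu₂ ≠ 0` — so the field is not a 1-D p-system shadow), and ONE genuinely nonlinear point (`D_b ≠ 0`: the slope function has
  `G' ≠ 0` there) ⟹ `False`.  This is the card's R3 («two-sided eternal rigidity of the autonomous genuinely nonlinear height-evolution»)
  together with ALL its named residual dangers (non-uniform thickness / hyperbolicity, degenerate set `{∇ₕu₂ = 0}`, one slope function per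
  component) — i.e. exactly what the stub asks of the KINEMATIC lever, with every Navier–Stokes input that survives on a single slice
  (analyticity, Type-I bounds, wedge law, globalised autonomy) handed over as a hypothesis on `u`.  Not in print (card §Hardest stub).
* `hTH` — the stub VERBATIM with one extra hypothesis: at the densely hyperbolic time `t₀` the genuine-nonlinearity defect vanishes
  identically (`D_b(t₀,·) ≡ 0`, `b = 0,1`: a «(TH)-instant», cf. `…ZShockThickInstants`: isolated in time, but not excluded at `t₀` by the
  stub as typed).  This is the planner-facing hole recorded by leafhand-2 g0 (L0-COMPLETE memo §8), now a named hypothesis of a kernel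
  theorem instead of a remark: on a (TH)-instant the slice obeys a GLOBAL constant slope law and the LINEAR wave equation, which has bounded
  eternal inhabitants, so `hTH` needs the (TH) column's dynamics, not R3.

Proof: case split on the existence of a genuinely nonlinear point on the slice `t₀`; in the GN case feed `hGN` with the slice, discharging
its hypotheses by tree theorems (`…Ancient.analyticOnNhd_slice`, `…ClassRate.exists_fderiv_rate_of_class`, the wedge law via the slab
pressure `exists_isClassicalNSSolutionOn_Iio_of_isTypeIAncientMild` + `…LocalFrozenLaw.vertShear_wedge_horizGrad_eq_zero` exactly as in
`…ZShockAutonomyPropagation`, `…ZShockAutonomyGlobal.minors_eq_zero_of_class_autonomy`, `…ZShockEllipticPocket.hypDiscriminant_nonpos_of_dense`)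
and the stub's own `hhyp` / `htw` at `z₀`; otherwise apply `hTH`.  HONEST LABEL: a reduction (repair census in the kernel), not a proof of
the stub; `hGN` is XL. [folklore]
-/

noncomputable section

namespace Summit.NavierStokesRegularity.NavierStokesRegularity.Theorems.PoloidalWindowDoorPoloidalWindowRigidityZShockAutReduction

-- the problem directory repeats the summit name (`NavierStokesRegularity/NavierStokesRegularity`)
set_option linter.dupNamespace false

open Set Filter Topology Function
open scoped RealInnerProductSpace InnerProductSpace
open Literature.Analysis Literature.Analysis.FluidPDE
open Summit.NavierStokesRegularity.NavierStokesRegularity.Theorems.LocalSineTubeDoorProfileAlignedWindowRigidityAncient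
open Summit.NavierStokesRegularity.NavierStokesRegularity.Theorems.PoloidalWindowDoorPoloidalWindowRigidityClassRate
open Summit.NavierStokesRegularity.NavierStokesRegularity.Theorems.PoloidalWindowDoorPoloidalWindowRigidityZShockAutonomyGlobal
open Summit.NavierStokesRegularity.NavierStokesRegularity.Theorems.PoloidalWindowDoorPoloidalWindowRigidityZShockEllipticPocket
open Summit.NavierStokesRegularity.NavierStokesRegularity.Theorems.PoloidalWindowDoorPoloidalWindowRigidityLocalFrozenLaw
  (vertShear_wedge_horizGrad_eq_zero)
open Summit.NavierStokesRegularity.NavierStokesRegularity.Theorems.PoloidalWindowDoorPoloidalWindowRigidityWindow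
  (isTypeIAncientMild_of_class)

/-- **The deciding stub `stub_zShockThickAut` of line `z_shock`, reduced to a class-free slice Liouville statement (`hGN`, the
genuinely nonlinear branch = the card's R3 with all residual dangers) and the (TH)-instant residue (`hTH`, the stub verbatim on a slice
whose genuine-nonlinearity defect vanishes identically).**  The conclusion is the registered type of `stub_zShockThickAut` VERBATIM.
See the module docstring for the reading of the two hypotheses. [folklore] -/
theorem stub_zShockThickAut_of_sliceLiouville_of_thInstant
    (hGN : ∀ (u : EuclideanSpace ℝ (Fin 3) → EuclideanSpace ℝ (Fin 3)),
      AnalyticOnNhd ℝ u Set.univ →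
      (∃ M : ℝ, ∀ x, ‖u x‖ ≤ M) →
      (∃ M₁ : ℝ, ∀ x, ‖fderiv ℝ u x‖ ≤ M₁) →
      Literature.Analysis.FluidPDE.VectorCalculus.IsDivFree u →
      (∀ y, ⟪Literature.Analysis.FluidPDE.curl u y, EuclideanSpace.single 2 1⟫_ℝ = 0) →
      (∀ y, fderiv ℝ u y (EuclideanSpace.single 2 1) 0 * fderiv ℝ u y (EuclideanSpace.single 1 1) 2 -
        fderiv ℝ u y (EuclideanSpace.single 2 1) 1 * fderiv ℝ u y (EuclideanSpace.single 0 1) 2 = 0) →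
      (∀ b : Fin 3, b ≠ 2 → ∀ x p q : EuclideanSpace ℝ (Fin 3),
        (fderiv ℝ u x (EuclideanSpace.single b 1) 2 *
              fderiv ℝ (fun y => fderiv ℝ u y (EuclideanSpace.single 2 1) b) x p -
            fderiv ℝ u x (EuclideanSpace.single 2 1) b *
              fderiv ℝ (fun y => fderiv ℝ u y (EuclideanSpace.single b 1) 2) x p) *
            fderiv ℝ (fun y => u y 2) x q -
          (fderiv ℝ u x (EuclideanSpace.single b 1) 2 *
              fderiv ℝ (fun y => fderiv ℝ u y (EuclideanSpace.single 2 1) b) x q -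
            fderiv ℝ u x (EuclideanSpace.single 2 1) b *
              fderiv ℝ (fun y => fderiv ℝ u y (EuclideanSpace.single b 1) 2) x q) *
            fderiv ℝ (fun y => u y 2) x p = 0) →
      (∀ y, fderiv ℝ u y (EuclideanSpace.single 2 1) 0 * fderiv ℝ u y (EuclideanSpace.single 0 1) 2 +
        fderiv ℝ u y (EuclideanSpace.single 2 1) 1 * fderiv ℝ u y (EuclideanSpace.single 1 1) 2 ≤ 0) →
      (∃ y, fderiv ℝ u y (EuclideanSpace.single 2 1) 0 * fderiv ℝ u y (EuclideanSpace.single 0 1) 2 +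
        fderiv ℝ u y (EuclideanSpace.single 2 1) 1 * fderiv ℝ u y (EuclideanSpace.single 1 1) 2 < 0) →
      (∃ y, fderiv ℝ (fun x => fderiv ℝ u x (EuclideanSpace.single 2 1) 2) y (EuclideanSpace.single 0 1) *
            fderiv ℝ u y (EuclideanSpace.single 1 1) 2 -
          fderiv ℝ (fun x => fderiv ℝ u x (EuclideanSpace.single 2 1) 2) y (EuclideanSpace.single 1 1) *
            fderiv ℝ u y (EuclideanSpace.single 0 1) 2 ≠ 0) →
      (∃ b : Fin 3, b ≠ 2 ∧ ∃ x p : EuclideanSpace ℝ (Fin 3),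
        fderiv ℝ u x (EuclideanSpace.single b 1) 2 *
            fderiv ℝ (fun y => fderiv ℝ u y (EuclideanSpace.single 2 1) b) x p -
          fderiv ℝ u x (EuclideanSpace.single 2 1) b *
            fderiv ℝ (fun y => fderiv ℝ u y (EuclideanSpace.single b 1) 2) x p ≠ 0) →
      False)
    (hTH : ∀ (C : ℝ) (v : ℝ → EuclideanSpace ℝ (Fin 3) → EuclideanSpace ℝ (Fin 3)),
      Literature.Analysis.FluidPDE.HasTypeITimeDecay C v →
      ContinuousOn (Function.uncurry v) (Set.Iio (0 : ℝ) ×ˢ Set.univ) →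
      (∀ s t : ℝ, s < t → t < 0 → ∀ x, v t x =
        Literature.Analysis.UnboundedOperators.heatExtension (v s) (t - s) x -
          Literature.Analysis.FluidPDE.oseenDuhamel 1 s v v t x) →
      (∀ t < 0, Literature.Analysis.FluidPDE.VectorCalculus.IsDivFree (v t)) →
      (∀ s < 0, ∀ y, ⟪Literature.Analysis.FluidPDE.curl (v s) y, EuclideanSpace.single 2 1⟫_ℝ = 0) →
      ∀ W : Set (ℝ × EuclideanSpace ℝ (Fin 3)), IsOpen W → W.Nonempty → W ⊆ Set.Iio (0 : ℝ) ×ˢ Set.univ →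
        (∀ z ∈ W, Literature.Analysis.FluidPDE.curl (v z.1) z.2 ≠ 0 ∧
          (fderiv ℝ (v z.1) z.2 (EuclideanSpace.single 0 1) 2 ≠ 0 ∨ fderiv ℝ (v z.1) z.2 (EuclideanSpace.single 1 1) 2 ≠ 0) ∧
          (fderiv ℝ (v z.1) z.2 (EuclideanSpace.single 2 1) 0 ≠ 0 ∨ fderiv ℝ (v z.1) z.2 (EuclideanSpace.single 2 1) 1 ≠ 0)) →
        (∀ m : ℝ → ℝ, ∀ W₁ : Set (ℝ × EuclideanSpace ℝ (Fin 3)), W₁ ⊆ W → IsOpen W₁ → W₁.Nonempty →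
          ∃ z ∈ W₁, ∃ b : Fin 3, b ≠ 2 ∧
            fderiv ℝ (v z.1) z.2 (EuclideanSpace.single 2 1) b ≠
              m z.1 * fderiv ℝ (v z.1) z.2 (EuclideanSpace.single b 1) 2) →
        (∀ z ∈ W,
          fderiv ℝ (fun x => fderiv ℝ (v z.1) x (EuclideanSpace.single 2 1) 2) z.2 (EuclideanSpace.single 0 1) *
              fderiv ℝ (v z.1) z.2 (EuclideanSpace.single 1 1) 2 -
            fderiv ℝ (fun x => fderiv ℝ (v z.1) x (EuclideanSpace.single 2 1) 2) z.2 (EuclideanSpace.single 1 1) *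
              fderiv ℝ (v z.1) z.2 (EuclideanSpace.single 0 1) 2 ≠ 0) →
        (∀ z ∈ W,
          fderiv ℝ (v z.1) z.2 (EuclideanSpace.single 2 1) 0 * fderiv ℝ (v z.1) z.2 (EuclideanSpace.single 0 1) 2 +
            fderiv ℝ (v z.1) z.2 (EuclideanSpace.single 2 1) 1 * fderiv ℝ (v z.1) z.2 (EuclideanSpace.single 1 1) 2 < 0) →
        (∀ m : ℝ → ℝ → ℝ, ∀ W₁ : Set (ℝ × EuclideanSpace ℝ (Fin 3)), W₁ ⊆ W → IsOpen W₁ → W₁.Nonempty →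
          ∃ z ∈ W₁, ∃ b : Fin 3, b ≠ 2 ∧
            fderiv ℝ (v z.1) z.2 (EuclideanSpace.single 2 1) b ≠
              m z.1 (z.2 2) * fderiv ℝ (v z.1) z.2 (EuclideanSpace.single b 1) 2) →
        ∀ z₀ ∈ W, Dense {y : EuclideanSpace ℝ (Fin 3) |
            fderiv ℝ (v z₀.1) y (EuclideanSpace.single 2 1) 0 * fderiv ℝ (v z₀.1) y (EuclideanSpace.single 0 1) 2 +
              fderiv ℝ (v z₀.1) y (EuclideanSpace.single 2 1) 1 * fderiv ℝ (v z₀.1) y (EuclideanSpace.single 1 1) 2 < 0} →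
        (∃ g : ℝ → ℝ → ℝ, ∃ W₁ : Set (ℝ × EuclideanSpace ℝ (Fin 3)), W₁ ⊆ W ∧ IsOpen W₁ ∧ z₀ ∈ W₁ ∧
          ∀ z ∈ W₁, ∀ b : Fin 3, b ≠ 2 →
            fderiv ℝ (v z.1) z.2 (EuclideanSpace.single 2 1) b =
              g z.1 (v z.1 z.2 2) * fderiv ℝ (v z.1) z.2 (EuclideanSpace.single b 1) 2) →
        (∀ b : Fin 3, b ≠ 2 → ∀ x p : EuclideanSpace ℝ (Fin 3),
          fderiv ℝ (v z₀.1) x (EuclideanSpace.single b 1) 2 *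
              fderiv ℝ (fun y => fderiv ℝ (v z₀.1) y (EuclideanSpace.single 2 1) b) x p -
            fderiv ℝ (v z₀.1) x (EuclideanSpace.single 2 1) b *
              fderiv ℝ (fun y => fderiv ℝ (v z₀.1) y (EuclideanSpace.single b 1) 2) x p = 0) →
        ¬ Literature.Analysis.FluidPDE.IsBackwardSingularPoint v 0) :
    ∀ (C : ℝ) (v : ℝ → EuclideanSpace ℝ (Fin 3) → EuclideanSpace ℝ (Fin 3)),
      Literature.Analysis.FluidPDE.HasTypeITimeDecay C v →
      ContinuousOn (Function.uncurry v) (Set.Iio (0 : ℝ) ×ˢ Set.univ) →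
      (∀ s t : ℝ, s < t → t < 0 → ∀ x, v t x =
        Literature.Analysis.UnboundedOperators.heatExtension (v s) (t - s) x -
          Literature.Analysis.FluidPDE.oseenDuhamel 1 s v v t x) →
      (∀ t < 0, Literature.Analysis.FluidPDE.VectorCalculus.IsDivFree (v t)) →
      (∀ s < 0, ∀ y, ⟪Literature.Analysis.FluidPDE.curl (v s) y, EuclideanSpace.single 2 1⟫_ℝ = 0) →
      ∀ W : Set (ℝ × EuclideanSpace ℝ (Fin 3)), IsOpen W → W.Nonempty → W ⊆ Set.Iio (0 : ℝ) ×ˢ Set.univ →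
        (∀ z ∈ W, Literature.Analysis.FluidPDE.curl (v z.1) z.2 ≠ 0 ∧
          (fderiv ℝ (v z.1) z.2 (EuclideanSpace.single 0 1) 2 ≠ 0 ∨ fderiv ℝ (v z.1) z.2 (EuclideanSpace.single 1 1) 2 ≠ 0) ∧
          (fderiv ℝ (v z.1) z.2 (EuclideanSpace.single 2 1) 0 ≠ 0 ∨ fderiv ℝ (v z.1) z.2 (EuclideanSpace.single 2 1) 1 ≠ 0)) →
        (∀ m : ℝ → ℝ, ∀ W₁ : Set (ℝ × EuclideanSpace ℝ (Fin 3)), W₁ ⊆ W → IsOpen W₁ → W₁.Nonempty →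
          ∃ z ∈ W₁, ∃ b : Fin 3, b ≠ 2 ∧
            fderiv ℝ (v z.1) z.2 (EuclideanSpace.single 2 1) b ≠
              m z.1 * fderiv ℝ (v z.1) z.2 (EuclideanSpace.single b 1) 2) →
        (∀ z ∈ W,
          fderiv ℝ (fun x => fderiv ℝ (v z.1) x (EuclideanSpace.single 2 1) 2) z.2 (EuclideanSpace.single 0 1) *
              fderiv ℝ (v z.1) z.2 (EuclideanSpace.single 1 1) 2 -
            fderiv ℝ (fun x => fderiv ℝ (v z.1) x (EuclideanSpace.single 2 1) 2) z.2 (EuclideanSpace.single 1 1) *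
              fderiv ℝ (v z.1) z.2 (EuclideanSpace.single 0 1) 2 ≠ 0) →
        (∀ z ∈ W,
          fderiv ℝ (v z.1) z.2 (EuclideanSpace.single 2 1) 0 * fderiv ℝ (v z.1) z.2 (EuclideanSpace.single 0 1) 2 +
            fderiv ℝ (v z.1) z.2 (EuclideanSpace.single 2 1) 1 * fderiv ℝ (v z.1) z.2 (EuclideanSpace.single 1 1) 2 < 0) →
        (∀ m : ℝ → ℝ → ℝ, ∀ W₁ : Set (ℝ × EuclideanSpace ℝ (Fin 3)), W₁ ⊆ W → IsOpen W₁ → W₁.Nonempty →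
          ∃ z ∈ W₁, ∃ b : Fin 3, b ≠ 2 ∧
            fderiv ℝ (v z.1) z.2 (EuclideanSpace.single 2 1) b ≠
              m z.1 (z.2 2) * fderiv ℝ (v z.1) z.2 (EuclideanSpace.single b 1) 2) →
        ∀ z₀ ∈ W, Dense {y : EuclideanSpace ℝ (Fin 3) |
            fderiv ℝ (v z₀.1) y (EuclideanSpace.single 2 1) 0 * fderiv ℝ (v z₀.1) y (EuclideanSpace.single 0 1) 2 +
              fderiv ℝ (v z₀.1) y (EuclideanSpace.single 2 1) 1 * fderiv ℝ (v z₀.1) y (EuclideanSpace.single 1 1) 2 < 0} →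
        (∃ g : ℝ → ℝ → ℝ, ∃ W₁ : Set (ℝ × EuclideanSpace ℝ (Fin 3)), W₁ ⊆ W ∧ IsOpen W₁ ∧ z₀ ∈ W₁ ∧
          ∀ z ∈ W₁, ∀ b : Fin 3, b ≠ 2 →
            fderiv ℝ (v z.1) z.2 (EuclideanSpace.single 2 1) b =
              g z.1 (v z.1 z.2 2) * fderiv ℝ (v z.1) z.2 (EuclideanSpace.single b 1) 2) →
        ¬ Literature.Analysis.FluidPDE.IsBackwardSingularPoint v 0 := by
  intro C v hrate hcont hmild hdiv hpol W hW hWne hWs hnd hpin htw hhyp hthick z₀ hz₀ hD hA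
  -- the densely hyperbolic slice time
  have ht₀ : z₀.1 < 0 := (Set.mem_prod.1 (hWs hz₀)).1
  by_cases hcase : ∃ b : Fin 3, b ≠ 2 ∧ ∃ x p : EuclideanSpace ℝ (Fin 3),
      fderiv ℝ (v z₀.1) x (EuclideanSpace.single b 1) 2 *
          fderiv ℝ (fun y => fderiv ℝ (v z₀.1) y (EuclideanSpace.single 2 1) b) x p -
        fderiv ℝ (v z₀.1) x (EuclideanSpace.single 2 1) b *
          fderiv ℝ (fun y => fderiv ℝ (v z₀.1) y (EuclideanSpace.single b 1) 2) x p ≠ 0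
  · -- GENUINELY NONLINEAR slice: the class-free slice Liouville statement applies to `u = v t₀`
    exfalso
    obtain ⟨g, W₁, hW₁W, hW₁o, hz₀W₁, haut⟩ := hA
    have hW₁s : W₁ ⊆ Set.Iio (0 : ℝ) ×ˢ Set.univ := hW₁W.trans hWs
    -- slice analyticity
    have han : AnalyticOnNhd ℝ (v z₀.1) univ :=
      analyticOnNhd_slice hcont (bdd_of_hasTypeITimeDecay hrate) hmild ht₀
    -- boundedness of the slice and of its gradient (Type-I rate; KNSS local smoothing)
    have hbd : ∃ M : ℝ, ∀ x, ‖v z₀.1 x‖ ≤ M := ⟨C / Real.sqrt (-z₀.1), fun x => hrate z₀.1 ht₀ x⟩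
    have hgrad : ∃ M₁ : ℝ, ∀ x, ‖fderiv ℝ (v z₀.1) x‖ ≤ M₁ := by
      obtain ⟨C₁, hC₁⟩ := exists_fderiv_rate_of_class hrate hcont hmild
      exact ⟨C₁ / (-z₀.1), fun x => hC₁ z₀.1 ht₀ x⟩
    -- the wedge law on the slice (poloidal classical solution with the slab pressure)
    obtain ⟨q, hq⟩ := exists_isClassicalNSSolutionOn_Iio_of_isTypeIAncientMild (isTypeIAncientMild_of_class hrate hcont hmild hdiv)
    have hslab : IsOpen (Set.Iio (0 : ℝ) ×ˢ (Set.univ : Set (EuclideanSpace ℝ (Fin 3)))) := isOpen_Iio.prod isOpen_univ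
    have hpol' : ∀ p ∈ Set.Iio (0 : ℝ) ×ˢ (Set.univ : Set (EuclideanSpace ℝ (Fin 3))),
        ⟪curl (v p.1) p.2, EuclideanSpace.single 2 (1 : ℝ)⟫_ℝ = 0 :=
      fun p hp => hpol p.1 (Set.mem_prod.1 hp).1 p.2
    have hwedge : ∀ y : EuclideanSpace ℝ (Fin 3),
        fderiv ℝ (v z₀.1) y (EuclideanSpace.single 2 1) 0 * fderiv ℝ (v z₀.1) y (EuclideanSpace.single 1 1) 2 -
          fderiv ℝ (v z₀.1) y (EuclideanSpace.single 2 1) 1 * fderiv ℝ (v z₀.1) y (EuclideanSpace.single 0 1) 2 = 0 :=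
      fun y => vertShear_wedge_horizGrad_eq_zero hslab hq.onRegion hpol' (p := (z₀.1, y)) (Set.mk_mem_prod ht₀ (Set.mem_univ y))
    -- L0(a): the autonomy minors vanish on the whole slice
    have hminors : ∀ b : Fin 3, b ≠ 2 → ∀ x p q' : EuclideanSpace ℝ (Fin 3),
        (fderiv ℝ (v z₀.1) x (EuclideanSpace.single b 1) 2 *
              fderiv ℝ (fun y => fderiv ℝ (v z₀.1) y (EuclideanSpace.single 2 1) b) x p -
            fderiv ℝ (v z₀.1) x (EuclideanSpace.single 2 1) b *
              fderiv ℝ (fun y => fderiv ℝ (v z₀.1) y (EuclideanSpace.single b 1) 2) x p) *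
            fderiv ℝ (fun y => v z₀.1 y 2) x q' -
          (fderiv ℝ (v z₀.1) x (EuclideanSpace.single b 1) 2 *
              fderiv ℝ (fun y => fderiv ℝ (v z₀.1) y (EuclideanSpace.single 2 1) b) x q' -
            fderiv ℝ (v z₀.1) x (EuclideanSpace.single 2 1) b *
              fderiv ℝ (fun y => fderiv ℝ (v z₀.1) y (EuclideanSpace.single b 1) 2) x q') *
            fderiv ℝ (fun y => v z₀.1 y 2) x p = 0 :=
      fun b hb x p q' => minors_eq_zero_of_class_autonomy C v hrate hcont hmild hW₁o hW₁s hz₀W₁ haut hb x p q'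
    -- no strictly elliptic point (`hdense` read pointwise), one strictly hyperbolic and one twisting point (the window point `z₀`)
    have hE : ∀ y : EuclideanSpace ℝ (Fin 3),
        fderiv ℝ (v z₀.1) y (EuclideanSpace.single 2 1) 0 * fderiv ℝ (v z₀.1) y (EuclideanSpace.single 0 1) 2 +
          fderiv ℝ (v z₀.1) y (EuclideanSpace.single 2 1) 1 * fderiv ℝ (v z₀.1) y (EuclideanSpace.single 1 1) 2 ≤ 0 :=
      hypDiscriminant_nonpos_of_dense hrate hcont hmild ht₀ hD
    exact hGN (v z₀.1) han hbd hgrad (hdiv z₀.1 ht₀) (hpol z₀.1 ht₀) hwedge hminors hE ⟨z₀.2, hhyp z₀ hz₀⟩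
      ⟨z₀.2, htw z₀ hz₀⟩ hcase
  · -- (TH)-INSTANT at the densely hyperbolic time: the residue hypothesis applies verbatim
    push Not at hcase
    exact hTH C v hrate hcont hmild hdiv hpol W hW hWne hWs hnd hpin htw hhyp hthick z₀ hz₀ hD hA hcase

end Summit.NavierStokesRegularity.NavierStokesRegularity.Theorems.PoloidalWindowDoorPoloidalWindowRigidityZShockAutReduction
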